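import Literature.NumberTheory.Automorphic.UnitaryGroupBorelInduction
import Literature.NumberTheory.Rogawski1990.CMLocalAPacketMembers
import Literature.NumberTheory.Automorphic.IrreducibleClassesConstituents
import HarnessLib

/-!
# Stub J2 «FROBENIUS for `SmoothInd`» of line `Cruxes/H413/Lines/F0_P2GR91NJacquet.lean` (LOCAL pay-down of the
# letter U′-N = ★ `GR91Lemma512NonsplitAsPrinted`): a non-zero `(P, χ δ_P^{1/2})`-equivariant functional on a smooth
# representation gives a non-zero intertwiner into the principal series

Cell hodgecm-mathlib F0∕P2, crux `stmt-HodgeConjecture-24833` (`H413`), PAY-DOWN OFFER of the F0P2-plan desk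
(2026-08-31T14:03:23Z), hand p01 = J2.  MODEL-FREE and generic: nothing here mentions the Weil representation.

Everything rests on the tree's PROVED Frobenius reciprocity for smooth induction
(★ `Representation.frobeniusInv`, `Representation.frobeniusMap_frobeniusInv`, `Representation.frobeniusEquiv`,
`Representation.frobeniusMap_bijective_holds` of `Literature/NumberTheory/Automorphic/SmoothInduction.lean`,
Bernstein–Zelevinsky 1976 Prop. 2.28 as printed in Bump 1997 Prop. 4.5.1):

* `frobeniusInv hπ` is injective; `frobeniusInv hπ φ = 0 ↔ φ = 0`; `(frobeniusInv hπ φ v) 1 = φ v`.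
* §1–§2 functional packaging: a `k`-linear `ℓ : V →ₗ[k] W` with `ℓ (π h v) = σ h (ℓ v)` (`h ∈ H`) is an `H`-map
  `π|_H → σ` (Mathlib `LinearMap.intertwiningMap_of_isIntertwiningMap`, no new definition); if `ℓ ≠ 0` and `π` is smooth
  there is `Φ : π → Ind_H^G σ`, `Φ ≠ 0`, `(Φ v) g = ℓ (π g v)`.
* §3 the same for NORMALISED induction ★ `Representation.normalizedInd t σ = Ind_P^G (σ ∘ proj ⊗ δ_P^{1/2})`
  (equivariance `ℓ (π p v) = δ_P^{1/2}(p) • σ (proj p) (ℓ v)`, `δ_P^{1/2}` = ★ `rootDeltaChar t.P` evaluated AT `p`).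
* §4 the CM head over ★ `cmPrincipalSeries L N v χ = i_G(χ)` of `U(Φ_N)(L⁺_v)` (★ `UnitaryGroupBorelInduction`):
  `ℓ (π p w) = χ (proj p) · δ_B^{1/2}(p) · ℓ w` on the Borel ★ `cmBorelTriple L N v` and `ℓ ≠ 0` give a non-zero
  `Φ : π → i_G(χ)` with `(Φ w) g = ℓ (π g w)`; for `N = 3` the group is ★ `Rogawski1990.Gqs L v` reducibly.

* §6 (ed. 2, appended) J2⁺: for an IRREDUCIBLE smooth source the non-zero intertwiner is injective (Schur, Mathlib
  ★ `Representation.IsIrreducible.injective_or_eq_zero`), so `⟦π⟧` IS A CONSTITUENT of the induced representation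
  (★ `IrrClass.isConstituentOf_mk_of_injective`) — generic and in the letter's tokens (`∃ x₀ ∈ JH(i_G(χ_ξ))`, `x₀ = ⟦π⟧`).

References: [BernsteinZelevinsky1976, Prop. 2.28]; [Bump1997, Prop. 4.5.1]; [BernsteinZelevinsky1977, §2.3];
[Rogawski1990, §12.1–§12.2]; [GelbartRogawski1991, §5.1].
-/

set_option autoImplicit false

set_option linter.dupNamespace false

noncomputable section

open NumberField IsDedekindDomain

namespace Summit.HodgeConjecture.HodgeConjecture.Cruxes.H413.F0P2nFrobeniusFunctional

open Literature.NumberTheory.Automorphic Literature.NumberTheory.Automorphic.UnitaryGroup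

/-! ## §1 Functional packaging: an `(H, σ)`-equivariant linear map is an `H`-map `π|_H → σ` -/

section Generic

variable {k G W V : Type*} [CommRing k] [Group G] [AddCommGroup W] [Module k W] [AddCommGroup V] [Module k V]
  {H : Subgroup G} {σ : Representation k H W} {π : Representation k G V}

/-- An `H`-equivariant `k`-linear `ℓ : V → W` (`ℓ (π h v) = σ h (ℓ v)`) IS an `H`-map `π|_H → σ` — Mathlib's
`LinearMap.intertwiningMap_of_isIntertwiningMap` on `π.comp H.subtype` (no new definition); it vanishes iff `ℓ` does. [folklore] -/
theorem intertwiningMap_of_functional_eq_zero_iff (ℓ : V →ₗ[k] W) (hℓ : ∀ (h : H) (v : V), ℓ (π h v) = σ h (ℓ v)) :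
    ℓ.intertwiningMap_of_isIntertwiningMap (π.comp H.subtype) σ (fun h v => hℓ h v) = 0 ↔ ℓ = 0 := by
  constructor
  · intro h
    ext v
    exact congrArg (fun F : Representation.IntertwiningMap (π.comp H.subtype) σ => F v) h
  · rintro rfl
    exact Representation.IntertwiningMap.ext rfl

/-! ## §2 Injectivity of the inverse Frobenius map; the generic head -/

variable [TopologicalSpace G] [SeparatelyContinuousMul G]

/-- `(frobeniusInv hπ φ v) 1 = φ v`: evaluation at `1` recovers the `H`-map (Bump 1997, proof of Prop. 4.5.1).
[cite: BernsteinZelevinsky1976, Proposition 2.28] -/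
theorem toFun_frobeniusInv_apply_one (hπ : π.IsSmooth) (φ : Representation.IntertwiningMap (π.comp H.subtype) σ)
    (v : V) : (Representation.frobeniusInv hπ φ v).toFun 1 = φ v := by
  rw [Representation.toFun_frobeniusInv_apply, map_one, Module.End.one_apply]

/-- The inverse Frobenius map `Hom_H(π|_H, σ) → Hom_G(π, Ind_H^G σ)` is injective (it has the left inverse
`frobeniusMap`, ★ `Representation.frobeniusMap_frobeniusInv`). [cite: BernsteinZelevinsky1976, Proposition 2.28] -/
theorem frobeniusInv_injective (hπ : π.IsSmooth) :
    Function.Injective (Representation.frobeniusInv (H := H) (σ := σ) hπ) :=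
  Function.LeftInverse.injective (g := Representation.frobeniusMap H σ π)
    (Representation.frobeniusMap_frobeniusInv hπ)

/-- `frobeniusInv hπ φ = 0 ↔ φ = 0`. [cite: BernsteinZelevinsky1976, Proposition 2.28] -/
theorem frobeniusInv_eq_zero_iff (hπ : π.IsSmooth) (φ : Representation.IntertwiningMap (π.comp H.subtype) σ) :
    Representation.frobeniusInv hπ φ = 0 ↔ φ = 0 := by
  constructor
  · intro h
    refine Representation.IntertwiningMap.ext (LinearMap.ext fun v => ?_)
    rw [Representation.IntertwiningMap.toLinearMap_apply, Representation.IntertwiningMap.toLinearMap_apply,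
      ← toFun_frobeniusInv_apply_one hπ φ v, h]
    rfl
  · rintro rfl
    refine Representation.IntertwiningMap.ext (LinearMap.ext fun v => Representation.SmoothInd.ext (funext fun g => ?_))
    rw [Representation.IntertwiningMap.toLinearMap_apply, Representation.toFun_frobeniusInv_apply]
    rfl

/-- A non-zero `H`-map `φ : π|_H → σ` gives a non-zero `G`-map `frobeniusInv hπ φ : π → Ind_H^G σ`.
[cite: BernsteinZelevinsky1976, Proposition 2.28] -/
theorem frobeniusInv_ne_zero (hπ : π.IsSmooth) {φ : Representation.IntertwiningMap (π.comp H.subtype) σ}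
    (hφ : φ ≠ 0) : Representation.frobeniusInv hπ φ ≠ 0 :=
  fun h => hφ ((frobeniusInv_eq_zero_iff hπ φ).1 h)

/-- **J2, generic form (Frobenius reciprocity, easy direction).**  For a smooth representation `π` of `G` and an
`H`-equivariant non-zero `k`-linear `ℓ : V → W` (`ℓ (π h v) = σ h (ℓ v)`), the map `Φ v := (g ↦ ℓ (π g v))` is a NON-ZERO
intertwiner `π → Ind_H^G σ` (★ `Representation.frobeniusInv`). [cite: BernsteinZelevinsky1976, Proposition 2.28] -/
theorem exists_intertwiningMap_smoothIndRep_of_functional (hπ : π.IsSmooth) (ℓ : V →ₗ[k] W)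
    (hℓ : ∀ (h : H) (v : V), ℓ (π h v) = σ h (ℓ v)) (hℓ0 : ℓ ≠ 0) :
    ∃ Φ : π.IntertwiningMap (Representation.smoothIndRep H σ), Φ ≠ 0 ∧ ∀ (v : V) (g : G), (Φ v).toFun g = ℓ (π g v) :=
  ⟨Representation.frobeniusInv hπ (ℓ.intertwiningMap_of_isIntertwiningMap (π.comp H.subtype) σ fun h v => hℓ h v),
    frobeniusInv_ne_zero hπ fun h => hℓ0 ((intertwiningMap_of_functional_eq_zero_iff ℓ hℓ).1 h),
    fun v g => Representation.toFun_frobeniusInv_apply hπ _ v g⟩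

/-- Pointed variant: if `ℓ v₀ ≠ 0` then `Φ v₀ ≠ 0` (indeed `(Φ v₀) 1 = ℓ v₀`). [cite: BernsteinZelevinsky1976, Proposition 2.28] -/
theorem exists_intertwiningMap_smoothIndRep_apply_ne_zero (hπ : π.IsSmooth) (ℓ : V →ₗ[k] W)
    (hℓ : ∀ (h : H) (v : V), ℓ (π h v) = σ h (ℓ v)) (v₀ : V) (hv₀ : ℓ v₀ ≠ 0) :
    ∃ Φ : π.IntertwiningMap (Representation.smoothIndRep H σ), Φ v₀ ≠ 0 ∧ ∀ (v : V) (g : G), (Φ v).toFun g = ℓ (π g v) := by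
  refine ⟨Representation.frobeniusInv hπ (ℓ.intertwiningMap_of_isIntertwiningMap (π.comp H.subtype) σ fun h v => hℓ h v),
    fun h => hv₀ ?_, fun v g => Representation.toFun_frobeniusInv_apply hπ _ v g⟩
  have h1 := congrArg (fun F : Representation.SmoothInd H σ => F.toFun 1) h
  rw [toFun_frobeniusInv_apply_one] at h1
  exact h1

end Generic

/-! ## §3 Normalised parabolic induction `i_P^G σ = Ind_P^G (σ ∘ proj ⊗ δ_P^{1/2})` -/

section Normalized

variable {G W V : Type*} [Group G] [TopologicalSpace G] [IsTopologicalGroup G] [AddCommGroup W] [Module ℂ W]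
  [AddCommGroup V] [Module ℂ V] (t : ParabolicTriple G) [LocallyCompactSpace t.P]

/-- The inducing representation of ★ `normalizedInd`: `(σ ∘ proj ⊗ δ_P^{1/2}) p w = δ_P^{1/2}(p) • σ (proj p) w`.
[cite: BernsteinZelevinsky1977, §2.3] -/
theorem twist_comp_proj_apply (σ : Representation ℂ t.M W) (p : t.P) (w : W) :
    Representation.twist (σ.comp t.proj) (rootDeltaChar t.P) p w = ((rootDeltaChar t.P p : ℂˣ) : ℂ) • σ (t.proj p) w :=
  rfl

/-- **J2 for normalised induction.**  For a smooth `π` and a non-zero `ℂ`-linear `ℓ : V → W` with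
`ℓ (π p v) = δ_P^{1/2}(p) • σ (proj p) (ℓ v)` (`p ∈ P`), there is a NON-ZERO intertwiner `Φ : π → i_P^G σ` with
`(Φ v) g = ℓ (π g v)`. [cite: BernsteinZelevinsky1977, §2.3] [cite: BernsteinZelevinsky1976, Proposition 2.28] -/
theorem exists_intertwiningMap_normalizedInd_of_functional (σ : Representation ℂ t.M W) (π : Representation ℂ G V)
    (hπ : π.IsSmooth) (ℓ : V →ₗ[ℂ] W)
    (hℓ : ∀ (p : t.P) (v : V), ℓ (π p v) = ((rootDeltaChar t.P p : ℂˣ) : ℂ) • σ (t.proj p) (ℓ v)) (hℓ0 : ℓ ≠ 0) :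
    ∃ Φ : π.IntertwiningMap (Representation.normalizedInd t σ), Φ ≠ 0 ∧ ∀ (v : V) (g : G), (Φ v).toFun g = ℓ (π g v) :=
  exists_intertwiningMap_smoothIndRep_of_functional hπ ℓ (fun p v => by rw [hℓ, twist_comp_proj_apply]) hℓ0

/-- Pointed variant for normalised induction: `ℓ v₀ ≠ 0` gives `Φ v₀ ≠ 0`.
[cite: BernsteinZelevinsky1977, §2.3] [cite: BernsteinZelevinsky1976, Proposition 2.28] -/
theorem exists_intertwiningMap_normalizedInd_apply_ne_zero (σ : Representation ℂ t.M W) (π : Representation ℂ G V)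
    (hπ : π.IsSmooth) (ℓ : V →ₗ[ℂ] W)
    (hℓ : ∀ (p : t.P) (v : V), ℓ (π p v) = ((rootDeltaChar t.P p : ℂˣ) : ℂ) • σ (t.proj p) (ℓ v)) (v₀ : V) (hv₀ : ℓ v₀ ≠ 0) :
    ∃ Φ : π.IntertwiningMap (Representation.normalizedInd t σ), Φ v₀ ≠ 0 ∧ ∀ (v : V) (g : G), (Φ v).toFun g = ℓ (π g v) :=
  exists_intertwiningMap_smoothIndRep_apply_ne_zero hπ ℓ (fun p v => by rw [hℓ, twist_comp_proj_apply]) v₀ hv₀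

/-- For a CHARACTER `χ` of `M` (one-dimensional `trivial ⊗ χ` on `ℂ`): the inducing representation of
`normalizedInd t ((trivial ℂ M ℂ).twist χ)` acts on `z ∈ ℂ` by `p ↦ χ (proj p) · δ_P^{1/2}(p) · z`.
[cite: BernsteinZelevinsky1977, §2.3] -/
theorem twist_comp_proj_character_apply (χ : t.M →* ℂˣ) (p : t.P) (z : ℂ) :
    Representation.twist (((Representation.trivial ℂ t.M ℂ).twist χ).comp t.proj) (rootDeltaChar t.P) p z =
      ((χ (t.proj p) : ℂˣ) : ℂ) * ((rootDeltaChar t.P p : ℂˣ) : ℂ) * z := by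
  rw [twist_comp_proj_apply, Representation.twist_apply, Representation.trivial_apply, smul_eq_mul, smul_eq_mul, ← mul_assoc,
    mul_comm ((rootDeltaChar t.P p : ℂˣ) : ℂ)]

/-- **J2 for the principal series of a character.**  `ℓ (π p v) = χ (proj p) · δ_P^{1/2}(p) · ℓ v` on `P` and `ℓ ≠ 0`
give a NON-ZERO `Φ : π → i_P^G χ` with `(Φ v) g = ℓ (π g v)`.
[cite: BernsteinZelevinsky1977, §2.3] [cite: BernsteinZelevinsky1976, Proposition 2.28] -/
theorem exists_intertwiningMap_normalizedInd_character_of_functional (χ : t.M →* ℂˣ) (π : Representation ℂ G V)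
    (hπ : π.IsSmooth) (ℓ : V →ₗ[ℂ] ℂ)
    (hℓ : ∀ (p : t.P) (v : V), ℓ (π p v) = ((χ (t.proj p) : ℂˣ) : ℂ) * ((rootDeltaChar t.P p : ℂˣ) : ℂ) * ℓ v) (hℓ0 : ℓ ≠ 0) :
    ∃ Φ : π.IntertwiningMap (Representation.normalizedInd t ((Representation.trivial ℂ t.M ℂ).twist χ)),
      Φ ≠ 0 ∧ ∀ (v : V) (g : G), (Φ v).toFun g = ℓ (π g v) :=
  exists_intertwiningMap_smoothIndRep_of_functional hπ ℓ
    (fun p v => by rw [hℓ, twist_comp_proj_character_apply]) hℓ0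

/-- Pointed variant for the principal series of a character: `ℓ v₀ ≠ 0` gives `Φ v₀ ≠ 0`.
[cite: BernsteinZelevinsky1977, §2.3] [cite: BernsteinZelevinsky1976, Proposition 2.28] -/
theorem exists_intertwiningMap_normalizedInd_character_apply_ne_zero (χ : t.M →* ℂˣ) (π : Representation ℂ G V)
    (hπ : π.IsSmooth) (ℓ : V →ₗ[ℂ] ℂ)
    (hℓ : ∀ (p : t.P) (v : V), ℓ (π p v) = ((χ (t.proj p) : ℂˣ) : ℂ) * ((rootDeltaChar t.P p : ℂˣ) : ℂ) * ℓ v)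
    (v₀ : V) (hv₀ : ℓ v₀ ≠ 0) :
    ∃ Φ : π.IntertwiningMap (Representation.normalizedInd t ((Representation.trivial ℂ t.M ℂ).twist χ)),
      Φ v₀ ≠ 0 ∧ ∀ (v : V) (g : G), (Φ v).toFun g = ℓ (π g v) :=
  exists_intertwiningMap_smoothIndRep_apply_ne_zero hπ ℓ
    (fun p v => by rw [hℓ, twist_comp_proj_character_apply]) v₀ hv₀

end Normalized

/-! ## §4 The CM head: the principal series `i_G(χ)` of `U(Φ_N)(L⁺_v)` -/

section CM

variable (L : Type) [Field L] [NumberField L] [IsCMField L]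

/-- **J2 «FROBENIUS for `SmoothInd`», CM head.**  Let `v` be a finite place of `L⁺`, `G = U(Φ_N)(L⁺_v)` (the carrier of
★ `cmBorelTriple L N v`; for `N = 3` this is ★ `Rogawski1990.Gqs L v` reducibly), `B = T N` its Borel triple, `χ` a character of
`T(L⁺_v)`, `π` a SMOOTH representation of `G` on `V` and `ℓ : V →ₗ[ℂ] ℂ` a NON-ZERO linear functional with
`ℓ (π p w) = χ (proj p) · δ_B^{1/2}(p) · ℓ w` for `p ∈ B(L⁺_v)` (`δ_B^{1/2}` = ★ `rootDeltaChar` AT `p`).  Then there is a NON-ZERO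
intertwiner `Φ : π → i_G(χ)` = ★ `cmPrincipalSeries L N v χ` with `(Φ w) g = ℓ (π g w)` (Frobenius reciprocity, easy direction).
[cite: BernsteinZelevinsky1976, Proposition 2.28] [cite: Rogawski1990, §12.2 p. 173] -/
theorem exists_intertwiningMap_cmPrincipalSeries_of_functional (N : ℕ) (v : HeightOneSpectrum (𝓞 ↥(maximalRealSubfield L)))
    (χ : ↥(torusU (conjLocal L (IsCMField.complexConj L) v) (cmLocalForm L N v)) →* ℂˣ)
    {V : Type*} [AddCommGroup V] [Module ℂ V]
    (π : Representation ℂ ↥(unitaryGroupOfForm (conjLocal L (IsCMField.complexConj L) v) (cmLocalForm L N v)) V)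
    (hπ : π.IsSmooth) (ℓ : V →ₗ[ℂ] ℂ)
    (hℓ : haveI := locallyCompactSpace_cmBorelU L N v
      ∀ (p : ↥(cmBorelTriple L N v).P) (w : V),
        ℓ (π p w) = ((χ ((cmBorelTriple L N v).proj p) : ℂˣ) : ℂ) * ((rootDeltaChar (cmBorelTriple L N v).P p : ℂˣ) : ℂ) * ℓ w)
    (hℓ0 : ℓ ≠ 0) :
    ∃ Φ : π.IntertwiningMap (cmPrincipalSeries L N v χ), Φ ≠ 0 ∧ ∀ (w : V) (g : _), (Φ w).toFun g = ℓ (π g w) :=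
  haveI := locallyCompactSpace_cmBorelU L N v
  exists_intertwiningMap_normalizedInd_character_of_functional (cmBorelTriple L N v) χ π hπ ℓ hℓ hℓ0

/-- Pointed CM head: if `ℓ w₀ ≠ 0` then `Φ w₀ ≠ 0` ((`Φ w₀) 1 = ℓ w₀`).
[cite: BernsteinZelevinsky1976, Proposition 2.28] [cite: Rogawski1990, §12.2 p. 173] -/
theorem exists_intertwiningMap_cmPrincipalSeries_apply_ne_zero (N : ℕ) (v : HeightOneSpectrum (𝓞 ↥(maximalRealSubfield L)))
    (χ : ↥(torusU (conjLocal L (IsCMField.complexConj L) v) (cmLocalForm L N v)) →* ℂˣ)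
    {V : Type*} [AddCommGroup V] [Module ℂ V]
    (π : Representation ℂ ↥(unitaryGroupOfForm (conjLocal L (IsCMField.complexConj L) v) (cmLocalForm L N v)) V)
    (hπ : π.IsSmooth) (ℓ : V →ₗ[ℂ] ℂ)
    (hℓ : haveI := locallyCompactSpace_cmBorelU L N v
      ∀ (p : ↥(cmBorelTriple L N v).P) (w : V),
        ℓ (π p w) = ((χ ((cmBorelTriple L N v).proj p) : ℂˣ) : ℂ) * ((rootDeltaChar (cmBorelTriple L N v).P p : ℂˣ) : ℂ) * ℓ w)
    (w₀ : V) (hw₀ : ℓ w₀ ≠ 0) :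
    ∃ Φ : π.IntertwiningMap (cmPrincipalSeries L N v χ), Φ w₀ ≠ 0 ∧ ∀ (w : V) (g : _), (Φ w).toFun g = ℓ (π g w) :=
  haveI := locallyCompactSpace_cmBorelU L N v
  exists_intertwiningMap_normalizedInd_character_apply_ne_zero (cmBorelTriple L N v) χ π hπ ℓ hℓ w₀ hw₀

/-! ## §5 The letter's tokens: `G = Gqs L v = U(Φ₃)(L⁺_v)`, `χ = χ_ξ = cmXiTorusChar L v μ η₁ η₂` -/

/-- **J2 in the currency of ★ `GR91Lemma512NonsplitAsPrinted`.**  For a smooth representation `π` of the quasi-split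
`U(3)(L⁺_v)` = ★ `Rogawski1990.Gqs L v` and a non-zero functional `ℓ` with
`ℓ (π p w) = χ_ξ (proj p) · δ_B^{1/2}(p) · ℓ w` on the Borel (`χ_ξ` = ★ `cmXiTorusChar L v μ η₁ η₂`, Rogawski §12.2 (2)), there is a
NON-ZERO intertwiner `Φ : π → i_G(χ_ξ)` = ★ `cmPrincipalSeries L 3 v (cmXiTorusChar L v μ η₁ η₂)` with `(Φ w) g = ℓ (π g w)` — the
map whose (irreducible) image stub J4 turns into «a constituent `x₀` of `i_G(χ_ξ)`».
[cite: BernsteinZelevinsky1976, Proposition 2.28] [cite: Rogawski1990, §12.2 p. 174] [cite: GelbartRogawski1991, §5.1 Lem. 5.1.2] -/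
theorem exists_intertwiningMap_cmPrincipalSeries_xi_of_functional (v : HeightOneSpectrum (𝓞 ↥(maximalRealSubfield L)))
    (μ : (LocalRing L v)ˣ →* ℂˣ) (η₁ η₂ : ↥(normOneUnits (conjLocal L (IsCMField.complexConj L) v)) →* ℂˣ)
    {V : Type*} [AddCommGroup V] [Module ℂ V] (π : Representation ℂ (Literature.NumberTheory.Rogawski1990.Gqs L v) V)
    (hπ : π.IsSmooth) (ℓ : V →ₗ[ℂ] ℂ)
    (hℓ : haveI := locallyCompactSpace_cmBorelU L 3 v
      ∀ (p : ↥(cmBorelTriple L 3 v).P) (w : V),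
        ℓ (π p.1 w) = ((cmXiTorusChar L v μ η₁ η₂ ((cmBorelTriple L 3 v).proj p) : ℂˣ) : ℂ) *
          ((rootDeltaChar (cmBorelTriple L 3 v).P p : ℂˣ) : ℂ) * ℓ w)
    (hℓ0 : ℓ ≠ 0) :
    ∃ Φ : π.IntertwiningMap (cmPrincipalSeries L 3 v (cmXiTorusChar L v μ η₁ η₂)),
      Φ ≠ 0 ∧ ∀ (w : V) (g : _), (Φ w).toFun g = ℓ (π g w) :=
  exists_intertwiningMap_cmPrincipalSeries_of_functional L 3 v (cmXiTorusChar L v μ η₁ η₂) π hπ ℓ hℓ hℓ0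

/-- Pointed form in the letter's tokens: `ℓ w₀ ≠ 0` gives `Φ w₀ ≠ 0`.
[cite: BernsteinZelevinsky1976, Proposition 2.28] [cite: Rogawski1990, §12.2 p. 174] -/
theorem exists_intertwiningMap_cmPrincipalSeries_xi_apply_ne_zero (v : HeightOneSpectrum (𝓞 ↥(maximalRealSubfield L)))
    (μ : (LocalRing L v)ˣ →* ℂˣ) (η₁ η₂ : ↥(normOneUnits (conjLocal L (IsCMField.complexConj L) v)) →* ℂˣ)
    {V : Type*} [AddCommGroup V] [Module ℂ V] (π : Representation ℂ (Literature.NumberTheory.Rogawski1990.Gqs L v) V)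
    (hπ : π.IsSmooth) (ℓ : V →ₗ[ℂ] ℂ)
    (hℓ : haveI := locallyCompactSpace_cmBorelU L 3 v
      ∀ (p : ↥(cmBorelTriple L 3 v).P) (w : V),
        ℓ (π p.1 w) = ((cmXiTorusChar L v μ η₁ η₂ ((cmBorelTriple L 3 v).proj p) : ℂˣ) : ℂ) *
          ((rootDeltaChar (cmBorelTriple L 3 v).P p : ℂˣ) : ℂ) * ℓ w)
    (w₀ : V) (hw₀ : ℓ w₀ ≠ 0) :
    ∃ Φ : π.IntertwiningMap (cmPrincipalSeries L 3 v (cmXiTorusChar L v μ η₁ η₂)),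
      Φ w₀ ≠ 0 ∧ ∀ (w : V) (g : _), (Φ w).toFun g = ℓ (π g w) :=
  exists_intertwiningMap_cmPrincipalSeries_apply_ne_zero L 3 v (cmXiTorusChar L v μ η₁ η₂) π hπ ℓ hℓ w₀ hw₀

end CM

/-! ## §6 J2⁺ (ed. 2, appended): an IRREDUCIBLE smooth source — its class is a CONSTITUENT of the induced representation

Mathlib's Schur dichotomy ★ `Representation.IsIrreducible.injective_or_eq_zero` (a `G`-map out of an irreducible
representation is injective or zero) and the tree's ★ `IrrClass.isConstituentOf_mk_of_injective` (an injective `G`-map from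
an irreducible smooth `σ` makes `⟦σ⟧` a constituent) turn the non-zero intertwiner of §2–§5 into the constituent statement
«`⟦π⟧ ∈ JH(Ind)`» — the first conjunct of ★ `GR91Lemma512NonsplitAsPrinted`'s conclusion, for an irreducible source. -/

section Constituent

universe u

variable {G : Type u} [Group G] [TopologicalSpace G]

/-- **A non-zero `G`-map out of an IRREDUCIBLE smooth representation exhibits its class as a constituent of the target**
(Schur: the map is injective, ★ `Representation.IsIrreducible.injective_or_eq_zero`; then ★ `IrrClass.isConstituentOf_mk_of_injective`).
[cite: BushnellHenniart2006, §2] -/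
theorem isConstituentOf_mk_of_intertwiningMap_ne_zero {V : Type*} [AddCommGroup V] [Module ℂ V] {W : Type} [AddCommGroup W]
    [Module ℂ W] {σ : Representation ℂ G W} (hirr : σ.IsIrreducible) (hsm : σ.IsSmooth) {ρ : Representation ℂ G V}
    (f : σ.IntertwiningMap ρ) (hf : f ≠ 0) :
    (IrrClass.mk { V := W, ρ := σ, isIrreducible := hirr, isSmooth := hsm }).IsConstituentOf ρ :=
  haveI := hirr
  IrrClass.isConstituentOf_mk_of_injective hirr hsm f
    ((Representation.IsIrreducible.injective_or_eq_zero f).resolve_right hf)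

variable [SeparatelyContinuousMul G]

/-- **J2⁺, generic.**  An IRREDUCIBLE smooth `π` on `W : Type` carrying a non-zero `(H, σ)`-equivariant functional
`ℓ` (`ℓ (π h v) = σ h (ℓ v)`) has its class `⟦π⟧` among the constituents of `Ind_H^G σ` (§2 + Schur).
[cite: BernsteinZelevinsky1976, Proposition 2.28] [cite: BushnellHenniart2006, §2] -/
theorem isConstituentOf_mk_smoothIndRep_of_functional {H : Subgroup G} {W' : Type*} [AddCommGroup W'] [Module ℂ W']
    {σ : Representation ℂ H W'} {W : Type} [AddCommGroup W] [Module ℂ W] {π : Representation ℂ G W}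
    (hirr : π.IsIrreducible) (hπ : π.IsSmooth) (ℓ : W →ₗ[ℂ] W') (hℓ : ∀ (h : H) (v : W), ℓ (π h v) = σ h (ℓ v)) (hℓ0 : ℓ ≠ 0) :
    (IrrClass.mk { V := W, ρ := π, isIrreducible := hirr, isSmooth := hπ }).IsConstituentOf (Representation.smoothIndRep H σ) := by
  obtain ⟨Φ, hΦ, -⟩ := exists_intertwiningMap_smoothIndRep_of_functional hπ ℓ hℓ hℓ0
  exact isConstituentOf_mk_of_intertwiningMap_ne_zero hirr hπ Φ hΦ

end Constituent

section ConstituentCM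

variable (L : Type) [Field L] [NumberField L] [IsCMField L]

/-- **J2⁺ in the letter's tokens.**  An IRREDUCIBLE smooth representation `π` of `U(3)(L⁺_v)` = ★ `Rogawski1990.Gqs L v` on
`W : Type` with a non-zero functional `ℓ`, `ℓ (π p w) = χ_ξ (proj p) · δ_B^{1/2}(p) · ℓ w` on the Borel, has its class `⟦π⟧`
among the constituents of `i_G(χ_ξ)` = ★ `cmPrincipalSeries L 3 v (cmXiTorusChar L v μ η₁ η₂)`:
`∃ x₀ : IrrClass (Gqs L v), x₀.IsConstituentOf (i_G(χ_ξ)) ∧ x₀ = ⟦π⟧` — the first conjunct of ★ `GR91Lemma512NonsplitAsPrinted`'s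
conclusion with the witness named (§5 + Schur ★ `Representation.IsIrreducible.injective_or_eq_zero` + ★ `IrrClass.isConstituentOf_mk_of_injective`).
[cite: BernsteinZelevinsky1976, Proposition 2.28] [cite: Rogawski1990, §12.2 p. 174] [cite: GelbartRogawski1991, §5.1 Lem. 5.1.2] -/
theorem isConstituentOf_mk_cmPrincipalSeries_xi_of_functional (v : HeightOneSpectrum (𝓞 ↥(maximalRealSubfield L)))
    (μ : (LocalRing L v)ˣ →* ℂˣ) (η₁ η₂ : ↥(normOneUnits (conjLocal L (IsCMField.complexConj L) v)) →* ℂˣ)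
    {W : Type} [AddCommGroup W] [Module ℂ W] (π : Representation ℂ (Literature.NumberTheory.Rogawski1990.Gqs L v) W)
    (hirr : π.IsIrreducible) (hπ : π.IsSmooth) (ℓ : W →ₗ[ℂ] ℂ)
    (hℓ : haveI := locallyCompactSpace_cmBorelU L 3 v
      ∀ (p : ↥(cmBorelTriple L 3 v).P) (w : W),
        ℓ (π p.1 w) = ((cmXiTorusChar L v μ η₁ η₂ ((cmBorelTriple L 3 v).proj p) : ℂˣ) : ℂ) *
          ((rootDeltaChar (cmBorelTriple L 3 v).P p : ℂˣ) : ℂ) * ℓ w)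
    (hℓ0 : ℓ ≠ 0) :
    (IrrClass.mk { V := W, ρ := π, isIrreducible := hirr, isSmooth := hπ }).IsConstituentOf
      (cmPrincipalSeries L 3 v (cmXiTorusChar L v μ η₁ η₂)) := by
  obtain ⟨Φ, hΦ, -⟩ := exists_intertwiningMap_cmPrincipalSeries_xi_of_functional L v μ η₁ η₂ π hπ ℓ hℓ hℓ0
  exact isConstituentOf_mk_of_intertwiningMap_ne_zero hirr hπ Φ hΦ

/-- The same, in the letter's `∃ x₀` shape with the witness recorded: `∃ x₀, x₀ ∈ JH(i_G(χ_ξ)) ∧ x₀ = ⟦π⟧`.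
[cite: Rogawski1990, §12.2 p. 174] [cite: GelbartRogawski1991, §5.1 Lem. 5.1.2] -/
theorem exists_isConstituentOf_cmPrincipalSeries_xi_of_functional (v : HeightOneSpectrum (𝓞 ↥(maximalRealSubfield L)))
    (μ : (LocalRing L v)ˣ →* ℂˣ) (η₁ η₂ : ↥(normOneUnits (conjLocal L (IsCMField.complexConj L) v)) →* ℂˣ)
    {W : Type} [AddCommGroup W] [Module ℂ W] (π : Representation ℂ (Literature.NumberTheory.Rogawski1990.Gqs L v) W)
    (hirr : π.IsIrreducible) (hπ : π.IsSmooth) (ℓ : W →ₗ[ℂ] ℂ)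
    (hℓ : haveI := locallyCompactSpace_cmBorelU L 3 v
      ∀ (p : ↥(cmBorelTriple L 3 v).P) (w : W),
        ℓ (π p.1 w) = ((cmXiTorusChar L v μ η₁ η₂ ((cmBorelTriple L 3 v).proj p) : ℂˣ) : ℂ) *
          ((rootDeltaChar (cmBorelTriple L 3 v).P p : ℂˣ) : ℂ) * ℓ w)
    (hℓ0 : ℓ ≠ 0) :
    ∃ x₀ : IrrClass (Literature.NumberTheory.Rogawski1990.Gqs L v),
      x₀.IsConstituentOf (cmPrincipalSeries L 3 v (cmXiTorusChar L v μ η₁ η₂)) ∧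
        x₀ = IrrClass.mk { V := W, ρ := π, isIrreducible := hirr, isSmooth := hπ } :=
  ⟨_, isConstituentOf_mk_cmPrincipalSeries_xi_of_functional L v μ η₁ η₂ π hirr hπ ℓ hℓ hℓ0, rfl⟩

end ConstituentCM

end Summit.HodgeConjecture.HodgeConjecture.Cruxes.H413.F0P2nFrobeniusFunctional

end
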